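import Summits.BirchSwinnertonDyer.BirchSwinnertonDyer.Theorems.GoldfeldAllTwistsTwoConverseTwinAdditiveInertTwistDescent
import Summits.BirchSwinnertonDyer.BirchSwinnertonDyer.Theorems.GoldfeldAllTwistsTwoConverseTwinGordPlacement
import Summits.BirchSwinnertonDyer.BirchSwinnertonDyer.Theorems.GoldfeldAllTwistsTwoConverseTwinTorsion
import Summits.BirchSwinnertonDyer.BirchSwinnertonDyer.Theorems.GoldfeldK12AdditiveTwoBaseChange
import Literature.NumberTheory.EllipticCurves.RationalPointInfiniteOrderCriteria
import Literature.NumberTheory.EllipticCurves.BSDInvariantsProofs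
import Summits.BirchSwinnertonDyer.BirchSwinnertonDyer.Theses.GoldfeldAllTwistsTwoConverse
import HarnessLib

set_option linter.dupNamespace false -- namespace `…BirchSwinnertonDyer.BirchSwinnertonDyer…` is the cell's (D-0017 nested layout)
set_option autoImplicit false

/-!
# K12₂″ (item 20044): two UNCONDITIONAL instances of its hypothesis beyond every tabulated range —
# `49a1^{(−13)}` (`N = 132496`) and `49a1^{(−26)}` (`N = 529984`) have `rank = 1`, `Ш[2^∞] = 0`,
# `corank_{ℤ₂} Sel_{2^∞} = 1`; the crux then asserts `ord_{s=1} L = 1` for them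

Cell `bsd-goldfeld`, seat `bsd-goldfeld-s1p-c201` (gen 3); `--supports stmt-BirchSwinnertonDyer-20044`
(`Summit.BirchSwinnertonDyer.BirchSwinnertonDyer.Theses.GoldfeldAllTwistsTwoConverse.RankOneTwoConverseCMSevenAdditiveTwo`,
K12₂″ = the rank-one `2`-converse on the ADDITIVE cell: globally minimal `W/ℚ`, `j = −3375`, not good at
`2`, `corank_{ℤ₂} Sel_{2^∞}(W/ℚ) = 1 ⟹ ord_{s=1} L(W, s) = 1`). PARTITION: none — RANK axis S1⁺;
types-the-object-of the additive-at-`2` cell (sub-cells `D ≡ 3 (mod 4)` and `D ≡ 6 (mod 8)` of the memo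
`K12PP-RINGCLASS.md`, i.e. the `Δ`-odd branch of the `2`-power ring-class tower of `ℚ(√−7)`, layers `0`
and `1`). HONEST FRAMING: nothing here proves the crux or any value of an `L`-function; BSD is not proved
by any of this. What IS proved, with no hypothesis and no named fact:

* `49a1^{(−13)}` (every `ℚ`-model `W`, `C • W = cm7.quadraticTwist (−13)`; conductor
  `2⁴·7²·13² = 132496`, Kodaira `I₄*` at `2` — Ogg: `f₂ = v₂(Δ_min) − m + 1 = 12 − 9 + 1`; the conductor
  value is quoted, not kernel-checked) has `rank W(ℚ) = 1`, `Ш(W/ℚ)[2^∞] = 0` and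
  `corank_{ℤ₂} Sel_{2^∞}(W/ℚ) = 1` (`rank_eq_one_twist_neg13`, `sha_primaryComponent_two_eq_bot_twist_neg13`,
  `selmerCorank_two_eq_one_twist_neg13`);
* the same for `49a1^{(−26)}` (conductor `2⁶·7²·13² = 529984 > 500000`, Kodaira `I₈*` at `2`), outside
  the range of Cremona's tables altogether (`…_twist_neg26`);
* hence the HYPOTHESIS class of K12₂″ is non-empty beyond the tree's printed rungs (Miller `N < 5000`,
  file 13; Cremona `N < 130000`, `GoldfeldK12AdditiveTwoRungs`): `exists_additiveCell_selmerCorank_two_eq_one`;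
* and the crux, taken BY NAME, asserts `ord_{s=1} L(W, s) = 1` for every model of these two curves
  (`analyticRank_eq_one_twist_neg13_of_rankOneTwoConverseCMSevenAdditiveTwo`, `…_neg26_…`) — a concrete,
  kernel-stated test of K12₂″ on named curves (numerically `ord_{s=1} L(W, s) = 1` for both: in the kit
  census j246894 of all additive twists with `|d| ≤ 3000`, evidence on the item, neither `d = −13` nor
  `d = −26` is among the `206` twists with `r_an ≥ 2`, and `L(W, 1) = 0` since `rank = 1`; not a theorem
  of the tree).

## Proof

The complete `2`-isogeny descents of the sibling seat c301 (`…TwinAdditiveInertTwistDescent`, parts V–VII: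
for `d ∈ {−m, −2m}`, `m` squarefree with all prime factors `≡ 1 (mod 4)` inert in `ℚ(√−7)`, EVERY model of
`49a1^{(d)}` has `rank ≤ 1`, and `rank = 1 ⇒ Ш[2] = 0`) at `m = 13` (`13 ≡ 1 (mod 4)`, `(−7/13) = −1`),
plus ONE explicit rational point on the two-torsion model `E_d : y² = x³ + 21d x² + 112d² x`:
`(56, 616) ∈ E_{−13}(ℚ)`, `(224, 896) ∈ E_{−26}(ℚ)`. The point is not torsion because `#E(ℚ)_tors = 2` for
every `ℚ(√−7)`-CM curve (c3, `torsionOrder_eq_two_of_j_eq`) and `(0,0)` is the non-zero torsion point;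
Mordell–Weil (`one_le_mordellWeilRank_of_not_isOfFinAddOrder_rat`) gives `rank ≥ 1`; so `rank = 1`,
`Ш[2] = 0`, `Ш[2^∞] = ⊥` (`primaryComponent_sha_eq_bot_of_forall`) and `corank₂ = rank + corank Ш[2^∞] = 1`
(Greenberg's identity, tree theorem `selmerCorank_eq_mordellWeilRank_add_holds`). The cell predicates
(`j = −3375`: `j_eq_neg3375_of_model_twist`; not good at `2`: Barrios et al. rows `I₀`,
`not_hasGoodReductionAtPrime_two_of_smul_eq_quadraticTwist`) feed the route decl verbatim.

## References

* J. H. Silverman, *The Arithmetic of Elliptic Curves*, 2nd ed. (2009), Thm. X.4.2(a), Prop. X.4.9,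
  VIII.6.7, VII.3. [SilvermanAEC2009]
* R. Greenberg, *Iwasawa theory for elliptic curves*, LNM 1716 (1999), §1. [Greenberg1999LNM]
* J. E. Cremona, *Algorithms for Modular Elliptic Curves*, 2nd ed. (1997), §3.7. [Cremona1997]

## Design

Theorems only (no `def`, no named fact, no `instance`/`notation`); the two models are written literally as
`⟨0, ((21 * (−13) : ℤ) : ℚ), 0, ((112 * (−13)^2 : ℤ) : ℚ), 0⟩` (the output shape of c301's
`smul_eq_twoTorsionModel_of_smul_eq_quadraticTwist`). Group law on `E(ℚ)` as Mathlib elaborates it over `ℚ`.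
-/

noncomputable section

open WeierstrassCurve Literature.NumberTheory.EllipticCurves

namespace Summit.BirchSwinnertonDyer.BirchSwinnertonDyer.Theorems.GoldfeldGoodTwists

/-! ## §1. Side conditions at `m = 13` -/

/-- `(−7/13) = −1`: `−7 ≡ 6` is not a square modulo `13`, i.e. `13` is inert in `ℚ(√−7)`. [folklore] -/
theorem not_isSquare_neg_seven_zmod_thirteen : ¬ IsSquare ((-7 : ℤ) : ZMod 13) := by decide

/-- The inert-twist side condition of c301's descent at `m = 13`: every prime factor of `13` is `≡ 1 (mod 4)`
and inert in `ℚ(√−7)`. [folklore] -/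
theorem inert_condition_thirteen :
    ∀ l : ℕ, l.Prime → l ∣ 13 → l % 4 = 1 ∧ ¬ IsSquare ((-7 : ℤ) : ZMod l) := by
  intro l hl hd
  obtain rfl : l = 13 := (Nat.prime_dvd_prime_iff_eq hl (by norm_num)).mp hd
  exact ⟨by norm_num, not_isSquare_neg_seven_zmod_thirteen⟩

/-- `13` is squarefree (a prime). [folklore] -/
theorem squarefree_thirteen : Squarefree (13 : ℕ) :=
  Irreducible.squarefree (show Nat.Prime 13 by norm_num)

/-- `rank` is invariant under admissible changes of variables (tree fact `mordellWeilRank_variableChange`,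
discharged). [cite: SilvermanAEC2009, Thm. VIII.6.7] -/
theorem mordellWeilRank_smul_eq (W : WeierstrassCurve ℚ) [W.IsElliptic] (C : VariableChange ℚ) :
    (C • W).mordellWeilRank = W.mordellWeilRank := by
  have h := mordellWeilRank_variableChange_holds W C
  unfold mordellWeilRank_variableChange at h
  convert h using 2

/-- A rational point `P ≠ O`, `P ≠ T` on a `ℚ(√−7)`-CM curve, where `T` is a rational point with `2T = O`,
`T ≠ O`, has infinite order: `#E(ℚ)_tors = 2` (c3, `torsionOrder_eq_two_of_j_eq`).
[cite: BurungaleCastellaSkinnerTian2022, Rem. D (p. 327)] [cite: SilvermanAEC2009, VII.3.1(b)] -/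
theorem not_isOfFinAddOrder_of_ne_of_j_eq (W : WeierstrassCurve ℚ) [W.IsElliptic]
    (hj : W.j = -3375 ∨ W.j = 16581375) {T P : W.toAffine.Point} (hT0 : T ≠ 0) (hT2 : 2 • T = 0)
    (hP0 : P ≠ 0) (hPT : P ≠ T) : ¬ IsOfFinAddOrder P := by
  intro hP
  have hcard : Nat.card (AddCommGroup.torsion W.toAffine.Point) = 2 := by
    rw [← torsionOrder_eq_natCard_torsion]; exact torsionOrder_eq_two_of_j_eq W hj
  have hTmem : T ∈ AddCommGroup.torsion W.toAffine.Point :=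
    isOfFinAddOrder_iff_nsmul_eq_zero.mpr ⟨2, by norm_num, hT2⟩
  have hPmem : P ∈ AddCommGroup.torsion W.toAffine.Point := hP
  obtain ⟨y, -, huniq⟩ :=
    (Nat.card_eq_two_iff' (0 : AddCommGroup.torsion W.toAffine.Point)).mp hcard
  have h1 : (⟨T, hTmem⟩ : AddCommGroup.torsion W.toAffine.Point) = y :=
    huniq _ fun h => hT0 (congrArg Subtype.val h)
  have h2 : (⟨P, hPmem⟩ : AddCommGroup.torsion W.toAffine.Point) = y :=
    huniq _ fun h => hP0 (congrArg Subtype.val h)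
  exact hPT (congrArg Subtype.val (h2.trans h1.symm))

/-! ## §2. `49a1^{(−13)}`: the model `E_{−13} : y² = x³ − 273x² + 18928x` and the point `(56, 616)` -/

/-- The two-torsion model of `49a1^{(−13)}` is a model: `C • E_{−13} = cm7.quadraticTwist (−13)` with
`C = (C₀ · 1)⁻¹`. [cite: SilvermanAEC2009, III.1] -/
theorem smul_twoTorsionModel_neg13 :
    ((⟨(Units.mk0 (2 : ℚ) two_ne_zero)⁻¹, 2 * ((-13 : ℤ) : ℚ), 0, 0⟩ : VariableChange ℚ) * 1)⁻¹ •
        (⟨0, ((21 * (-13) : ℤ) : ℚ), 0, ((112 * (-13) ^ 2 : ℤ) : ℚ), 0⟩ : WeierstrassCurve ℚ) =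
      cm7.quadraticTwist ((-13 : ℤ) : ℚ) := by
  rw [← smul_eq_twoTorsionModel_of_smul_eq_quadraticTwist (-13) (cm7.quadraticTwist ((-13 : ℤ) : ℚ)) 1
    (one_smul _ _), inv_smul_smul]

/-- `E_{−13}` is an elliptic curve (`b(a² − 4b) = −784·13⁴ ≠ 0`). [folklore] -/
theorem isElliptic_twoTorsionModel_neg13 :
    (⟨0, ((21 * (-13) : ℤ) : ℚ), 0, ((112 * (-13) ^ 2 : ℤ) : ℚ), 0⟩ : WeierstrassCurve ℚ).IsElliptic :=
  isElliptic_mk_of_ne_zero (F := ℚ) (by norm_num)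

/-- `(56, 616)` is a (nonsingular) rational point of `E_{−13}`: `616² = 379456 = 56³ − 273·56² + 18928·56`.
[folklore] -/
theorem nonsingular_56_616 :
    (⟨0, ((21 * (-13) : ℤ) : ℚ), 0, ((112 * (-13) ^ 2 : ℤ) : ℚ), 0⟩ : WeierstrassCurve ℚ).toAffine.Nonsingular
      56 616 := by
  haveI := isElliptic_twoTorsionModel_neg13
  refine Affine.equation_iff_nonsingular.mp ?_
  rw [Affine.equation_iff]
  push_cast
  norm_num

/-- `(0, 0)` is a (nonsingular) rational point of `E_{−13}` (the rational `2`-torsion point). [folklore] -/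
theorem nonsingular_origin_neg13 :
    (⟨0, ((21 * (-13) : ℤ) : ℚ), 0, ((112 * (-13) ^ 2 : ℤ) : ℚ), 0⟩ : WeierstrassCurve ℚ).toAffine.Nonsingular
      0 0 := by
  rw [Affine.nonsingular_zero]
  refine ⟨rfl, Or.inr ?_⟩
  show ((112 * (-13) ^ 2 : ℤ) : ℚ) ≠ 0
  norm_num

/-- `(56, 616) ∈ E_{−13}(ℚ)` has infinite order. [cite: SilvermanAEC2009, VII.3.1(b)] -/
theorem not_isOfFinAddOrder_56_616 :
    ¬ IsOfFinAddOrder (Affine.Point.some 56 616 nonsingular_56_616) := by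
  haveI := isElliptic_twoTorsionModel_neg13
  have hj := j_eq_neg3375_of_model_twist cm7 j_cm7 (t := ((-13 : ℤ) : ℚ)) (by norm_num)
    (⟨0, ((21 * (-13) : ℤ) : ℚ), 0, ((112 * (-13) ^ 2 : ℤ) : ℚ), 0⟩ : WeierstrassCurve ℚ)
    ⟨_, smul_eq_twoTorsionModel_of_smul_eq_quadraticTwist (-13) _ 1 (one_smul _ _)⟩
  refine not_isOfFinAddOrder_of_ne_of_j_eq _ (Or.inl hj) (T := Affine.Point.some 0 0 nonsingular_origin_neg13)
    (Affine.Point.some_ne_zero _) ?_ (Affine.Point.some_ne_zero _) ?_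
  · rw [two_nsmul]
    exact Affine.Point.add_of_Y_eq rfl (by simp [Affine.negY])
  · intro h
    simp only [Affine.Point.some.injEq] at h
    norm_num at h

/-- **`rank E_{−13}(ℚ) = 1`**, unconditionally: `≤ 1` by c301's complete `2`-isogeny descent
(`rank_le_one_and_sha_two_inertTwist`, `m = 13`), `≥ 1` by the point `(56, 616)` and Mordell–Weil.
[cite: SilvermanAEC2009, Thm. X.4.2(a), Prop. X.4.9, Thm. VIII.6.7] -/
theorem rank_twoTorsionModel_neg13 :
    (⟨0, ((21 * (-13) : ℤ) : ℚ), 0, ((112 * (-13) ^ 2 : ℤ) : ℚ), 0⟩ : WeierstrassCurve ℚ).mordellWeilRank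
      = 1 := by
  haveI := isElliptic_twoTorsionModel_neg13
  refine le_antisymm ?_ (one_le_mordellWeilRank_of_not_isOfFinAddOrder_rat _ not_isOfFinAddOrder_56_616)
  have h := rank_le_one_and_sha_two_inertTwist (m := 13) (by norm_num) squarefree_thirteen inert_condition_thirteen
    _ _ ((smul_twoTorsionModel_neg13).trans (by norm_num))
  exact h.1

/-! ## §3. `49a1^{(−13)}`: every model -/

/-- **UNCONDITIONAL: `rank W(ℚ) = 1` for every model `W` of `49a1^{(−13)}`** (conductor `132496`).
[cite: SilvermanAEC2009, Thm. X.4.2(a), Prop. X.4.9, Thm. VIII.6.7] -/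
theorem rank_eq_one_twist_neg13 (W : WeierstrassCurve ℚ) [W.IsElliptic] (C : VariableChange ℚ)
    (hC : C • W = cm7.quadraticTwist (-13)) : W.mordellWeilRank = 1 := by
  haveI := isElliptic_twoTorsionModel_neg13
  have hC' : C • W = cm7.quadraticTwist ((-13 : ℤ) : ℚ) := by rw [hC]; norm_num
  have hE := smul_eq_twoTorsionModel_of_smul_eq_quadraticTwist (-13) W C hC'
  have hr := mordellWeilRank_smul_eq W
    ((⟨(Units.mk0 (2 : ℚ) two_ne_zero)⁻¹, 2 * ((-13 : ℤ) : ℚ), 0, 0⟩ : VariableChange ℚ) * C)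
  rw [hE] at hr
  rw [← hr]
  exact rank_twoTorsionModel_neg13

/-- **UNCONDITIONAL: `Ш(W/ℚ)[2] = 0` for every model `W` of `49a1^{(−13)}`.**
[cite: SilvermanAEC2009, Thm. X.4.2(a), Prop. X.4.9, Thm. III.6.2(a)] -/
theorem forall_mem_sha_two_twist_neg13 (W : WeierstrassCurve ℚ) [W.IsElliptic] (C : VariableChange ℚ)
    (hC : C • W = cm7.quadraticTwist (-13)) : ∀ c ∈ W.sha, 2 • c = 0 → c = 0 := by
  have hC' : C • W = cm7.quadraticTwist ((-(13 : ℕ) : ℤ) : ℚ) := by rw [hC]; norm_num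
  exact (rank_le_one_and_sha_two_inertTwist (m := 13) (by norm_num) squarefree_thirteen inert_condition_thirteen
    W C hC').2 (rank_eq_one_twist_neg13 W C hC)

/-- **UNCONDITIONAL: `Ш(W/ℚ)[2^∞] = 0` for every model `W` of `49a1^{(−13)}`.** [cite: SilvermanAEC2009, Thm. X.4.2(a)] -/
theorem sha_primaryComponent_two_eq_bot_twist_neg13 (W : WeierstrassCurve ℚ) [W.IsElliptic]
    (C : VariableChange ℚ) (hC : C • W = cm7.quadraticTwist (-13)) :
    AddCommGroup.primaryComponent W.sha 2 = ⊥ :=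
  W.primaryComponent_sha_eq_bot_of_forall (forall_mem_sha_two_twist_neg13 W C hC)

/-- **UNCONDITIONAL: `corank_{ℤ₂} Sel_{2^∞}(W/ℚ) = 1` for every model `W` of `49a1^{(−13)}`** — the
HYPOTHESIS of K12₂″ holds for this curve (`corank = rank + corank Ш[2^∞] = 1 + 0`).
[cite: Greenberg1999LNM, §1 pp. 54–57] [cite: SilvermanAEC2009, Thm. X.4.2(a)] -/
theorem selmerCorank_two_eq_one_twist_neg13 (W : WeierstrassCurve ℚ) [W.IsElliptic] (C : VariableChange ℚ)
    (hC : C • W = cm7.quadraticTwist (-13)) : W.selmerCorank 2 = 1 := by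
  haveI : Fact (Nat.Prime 2) := ⟨Nat.prime_two⟩
  rw [W.selmerCorank_eq_mordellWeilRank_add_holds 2, rank_eq_one_twist_neg13 W C hC,
    W.shaCorank_eq_zero_of_forall 2 (forall_mem_sha_two_twist_neg13 W C hC)]

/-! ## §4. `49a1^{(−26)}`: the model `E_{−26} : y² = x³ − 546x² + 75712x` and the point `(224, 896)` -/

/-- `C • E_{−26} = cm7.quadraticTwist (−26)` with `C = (C₀ · 1)⁻¹`. [cite: SilvermanAEC2009, III.1] -/
theorem smul_twoTorsionModel_neg26 :
    ((⟨(Units.mk0 (2 : ℚ) two_ne_zero)⁻¹, 2 * ((-26 : ℤ) : ℚ), 0, 0⟩ : VariableChange ℚ) * 1)⁻¹ •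
        (⟨0, ((21 * (-26) : ℤ) : ℚ), 0, ((112 * (-26) ^ 2 : ℤ) : ℚ), 0⟩ : WeierstrassCurve ℚ) =
      cm7.quadraticTwist ((-26 : ℤ) : ℚ) := by
  rw [← smul_eq_twoTorsionModel_of_smul_eq_quadraticTwist (-26) (cm7.quadraticTwist ((-26 : ℤ) : ℚ)) 1
    (one_smul _ _), inv_smul_smul]

/-- `E_{−26}` is an elliptic curve. [folklore] -/
theorem isElliptic_twoTorsionModel_neg26 :
    (⟨0, ((21 * (-26) : ℤ) : ℚ), 0, ((112 * (-26) ^ 2 : ℤ) : ℚ), 0⟩ : WeierstrassCurve ℚ).IsElliptic :=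
  isElliptic_mk_of_ne_zero (F := ℚ) (by norm_num)

/-- `(224, 896)` is a (nonsingular) rational point of `E_{−26}`: `896² = 802816 = 224³ − 546·224² + 75712·224`.
[folklore] -/
theorem nonsingular_224_896 :
    (⟨0, ((21 * (-26) : ℤ) : ℚ), 0, ((112 * (-26) ^ 2 : ℤ) : ℚ), 0⟩ : WeierstrassCurve ℚ).toAffine.Nonsingular
      224 896 := by
  haveI := isElliptic_twoTorsionModel_neg26
  refine Affine.equation_iff_nonsingular.mp ?_
  rw [Affine.equation_iff]
  push_cast
  norm_num

/-- `(0, 0)` is a (nonsingular) rational point of `E_{−26}`. [folklore] -/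
theorem nonsingular_origin_neg26 :
    (⟨0, ((21 * (-26) : ℤ) : ℚ), 0, ((112 * (-26) ^ 2 : ℤ) : ℚ), 0⟩ : WeierstrassCurve ℚ).toAffine.Nonsingular
      0 0 := by
  rw [Affine.nonsingular_zero]
  refine ⟨rfl, Or.inr ?_⟩
  show ((112 * (-26) ^ 2 : ℤ) : ℚ) ≠ 0
  norm_num

/-- `(224, 896) ∈ E_{−26}(ℚ)` has infinite order. [cite: SilvermanAEC2009, VII.3.1(b)] -/
theorem not_isOfFinAddOrder_224_896 :
    ¬ IsOfFinAddOrder (Affine.Point.some 224 896 nonsingular_224_896) := by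
  haveI := isElliptic_twoTorsionModel_neg26
  have hj := j_eq_neg3375_of_model_twist cm7 j_cm7 (t := ((-26 : ℤ) : ℚ)) (by norm_num)
    (⟨0, ((21 * (-26) : ℤ) : ℚ), 0, ((112 * (-26) ^ 2 : ℤ) : ℚ), 0⟩ : WeierstrassCurve ℚ)
    ⟨_, smul_eq_twoTorsionModel_of_smul_eq_quadraticTwist (-26) _ 1 (one_smul _ _)⟩
  refine not_isOfFinAddOrder_of_ne_of_j_eq _ (Or.inl hj) (T := Affine.Point.some 0 0 nonsingular_origin_neg26)
    (Affine.Point.some_ne_zero _) ?_ (Affine.Point.some_ne_zero _) ?_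
  · rw [two_nsmul]
    exact Affine.Point.add_of_Y_eq rfl (by simp [Affine.negY])
  · intro h
    simp only [Affine.Point.some.injEq] at h
    norm_num at h

/-- **`rank E_{−26}(ℚ) = 1`**, unconditionally (c301's descent for `49a1^{(−2m)}`, `m = 13`, and the point
`(224, 896)`). [cite: SilvermanAEC2009, Thm. X.4.2(a), Prop. X.4.9, Thm. VIII.6.7] -/
theorem rank_twoTorsionModel_neg26 :
    (⟨0, ((21 * (-26) : ℤ) : ℚ), 0, ((112 * (-26) ^ 2 : ℤ) : ℚ), 0⟩ : WeierstrassCurve ℚ).mordellWeilRank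
      = 1 := by
  haveI := isElliptic_twoTorsionModel_neg26
  refine le_antisymm ?_ (one_le_mordellWeilRank_of_not_isOfFinAddOrder_rat _ not_isOfFinAddOrder_224_896)
  have h := rank_le_one_and_sha_two_inertTwoTwist (m := 13) (by norm_num) squarefree_thirteen
    inert_condition_thirteen _ _ ((smul_twoTorsionModel_neg26).trans (by norm_num))
  exact h.1

/-! ## §5. `49a1^{(−26)}`: every model -/

/-- **UNCONDITIONAL: `rank W(ℚ) = 1` for every model `W` of `49a1^{(−26)}`** (conductor `529984 > 500000`).
[cite: SilvermanAEC2009, Thm. X.4.2(a), Prop. X.4.9, Thm. VIII.6.7] -/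
theorem rank_eq_one_twist_neg26 (W : WeierstrassCurve ℚ) [W.IsElliptic] (C : VariableChange ℚ)
    (hC : C • W = cm7.quadraticTwist (-26)) : W.mordellWeilRank = 1 := by
  haveI := isElliptic_twoTorsionModel_neg26
  have hC' : C • W = cm7.quadraticTwist ((-26 : ℤ) : ℚ) := by rw [hC]; norm_num
  have hE := smul_eq_twoTorsionModel_of_smul_eq_quadraticTwist (-26) W C hC'
  have hr := mordellWeilRank_smul_eq W
    ((⟨(Units.mk0 (2 : ℚ) two_ne_zero)⁻¹, 2 * ((-26 : ℤ) : ℚ), 0, 0⟩ : VariableChange ℚ) * C)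
  rw [hE] at hr
  rw [← hr]
  exact rank_twoTorsionModel_neg26

/-- **UNCONDITIONAL: `Ш(W/ℚ)[2] = 0` for every model `W` of `49a1^{(−26)}`.**
[cite: SilvermanAEC2009, Thm. X.4.2(a), Prop. X.4.9, Thm. III.6.2(a)] -/
theorem forall_mem_sha_two_twist_neg26 (W : WeierstrassCurve ℚ) [W.IsElliptic] (C : VariableChange ℚ)
    (hC : C • W = cm7.quadraticTwist (-26)) : ∀ c ∈ W.sha, 2 • c = 0 → c = 0 := by
  have hC' : C • W = cm7.quadraticTwist ((-2 * (13 : ℕ) : ℤ) : ℚ) := by rw [hC]; norm_num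
  exact (rank_le_one_and_sha_two_inertTwoTwist (m := 13) (by norm_num) squarefree_thirteen inert_condition_thirteen
    W C hC').2 (rank_eq_one_twist_neg26 W C hC)

/-- **UNCONDITIONAL: `Ш(W/ℚ)[2^∞] = 0` for every model `W` of `49a1^{(−26)}`.** [cite: SilvermanAEC2009, Thm. X.4.2(a)] -/
theorem sha_primaryComponent_two_eq_bot_twist_neg26 (W : WeierstrassCurve ℚ) [W.IsElliptic]
    (C : VariableChange ℚ) (hC : C • W = cm7.quadraticTwist (-26)) :
    AddCommGroup.primaryComponent W.sha 2 = ⊥ :=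
  W.primaryComponent_sha_eq_bot_of_forall (forall_mem_sha_two_twist_neg26 W C hC)

/-- **UNCONDITIONAL: `corank_{ℤ₂} Sel_{2^∞}(W/ℚ) = 1` for every model `W` of `49a1^{(−26)}`** — the
HYPOTHESIS of K12₂″ holds for this curve of conductor `529984`. [cite: Greenberg1999LNM, §1 pp. 54–57] -/
theorem selmerCorank_two_eq_one_twist_neg26 (W : WeierstrassCurve ℚ) [W.IsElliptic] (C : VariableChange ℚ)
    (hC : C • W = cm7.quadraticTwist (-26)) : W.selmerCorank 2 = 1 := by
  haveI : Fact (Nat.Prime 2) := ⟨Nat.prime_two⟩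
  rw [W.selmerCorank_eq_mordellWeilRank_add_holds 2, rank_eq_one_twist_neg26 W C hC,
    W.shaCorank_eq_zero_of_forall 2 (forall_mem_sha_two_twist_neg26 W C hC)]

/-! ## §6. The cell predicates and the crux BY NAME -/

/-- Every model of `49a1^{(−13)}` or `49a1^{(−26)}` is NOT good at `2` (Barrios et al. rows `I₀`:
`−13 ≡ 3`, `−26 ≡ 2 (mod 4)`). [cite: BarriosEtAl2025, Thm. 5.1 rows R = I₀ (arXiv:2501.03209 pp. 15–16)] -/
theorem not_hasGoodReductionAtPrime_two_twist_neg13_neg26 (W : WeierstrassCurve ℚ) [W.IsElliptic]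
    (C : VariableChange ℚ) {d : ℤ} (hd : d = -13 ∨ d = -26) (hC : C • W = cm7.quadraticTwist (d : ℚ)) :
    ¬ W.HasGoodReductionAtPrime 2 :=
  not_hasGoodReductionAtPrime_two_of_smul_eq_quadraticTwist cm7 W hasGoodReductionAtPrime_cm7_two
    (by rcases hd with rfl | rfl <;> decide) hC

/-- **Non-vacuity of K12₂″'s hypothesis beyond the printed rungs, kernel-certified**: there is a globally
minimal elliptic curve `W/ℚ` with `j(W) = −3375`, NOT good at `2`, `corank_{ℤ₂} Sel_{2^∞}(W/ℚ) = 1`,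
`rank W(ℚ) = 1` and `Ш(W/ℚ)[2^∞] = 0` — a minimal model of `49a1^{(−26)}` (conductor `529984`, outside
Cremona's tables `N < 500000` and the tree's rung `N < 130000`). Unconditional.
[cite: SilvermanAEC2009, Thm. X.4.2(a), VIII.8 Cor. 8.3] [cite: Greenberg1999LNM, §1] -/
theorem exists_additiveCell_selmerCorank_two_eq_one :
    ∃ (W : WeierstrassCurve ℚ) (_ : W.IsElliptic) (_ : W.IsGloballyMinimal),
      W.j = -3375 ∧ ¬ W.HasGoodReductionAtPrime 2 ∧ W.selmerCorank 2 = 1 ∧ W.mordellWeilRank = 1 ∧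
        AddCommGroup.primaryComponent W.sha 2 = ⊥ ∧
        ∃ C : VariableChange ℚ, C • W = cm7.quadraticTwist (-26) := by
  haveI := isElliptic_twoTorsionModel_neg26
  obtain ⟨C', hmin⟩ := hasGlobalMinimalModel_rat_holds
    (⟨0, ((21 * (-26) : ℤ) : ℚ), 0, ((112 * (-26) ^ 2 : ℤ) : ℚ), 0⟩ : WeierstrassCurve ℚ)
  haveI := hmin
  -- the minimal model is again a model of the twist
  have hC : (((⟨(Units.mk0 (2 : ℚ) two_ne_zero)⁻¹, 2 * ((-26 : ℤ) : ℚ), 0, 0⟩ : VariableChange ℚ) * 1)⁻¹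
      * C'⁻¹) • (C' • (⟨0, ((21 * (-26) : ℤ) : ℚ), 0, ((112 * (-26) ^ 2 : ℤ) : ℚ), 0⟩ : WeierstrassCurve ℚ)) =
      cm7.quadraticTwist (-26) := by
    rw [mul_smul, inv_smul_smul, smul_twoTorsionModel_neg26]; norm_num
  refine ⟨_, inferInstance, hmin, ?_, ?_, selmerCorank_two_eq_one_twist_neg26 _ _ hC,
    rank_eq_one_twist_neg26 _ _ hC, sha_primaryComponent_two_eq_bot_twist_neg26 _ _ hC, _, hC⟩
  · exact j_eq_neg3375_of_model_twist cm7 j_cm7 (t := (-26 : ℚ)) (by norm_num) _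
      ⟨_, (eq_inv_smul_iff.mpr hC).symm⟩
  · exact not_hasGoodReductionAtPrime_two_twist_neg13_neg26 _ _ (Or.inr rfl) (by rw [hC]; norm_num)

/-- **K12₂″ BY NAME ⟹ `ord_{s=1} L(49a1^{(−13)}, s) = 1`** (every model; the crux applied to a minimal
model, then `analyticRank` is model-independent). The conclusion is NOT a theorem of the tree (numerically
`r_an = 1`, kit census j246894): a concrete kernel-stated test of the crux at conductor `132496`.
[cite: SilvermanAEC2009, App. C §16] -/
theorem analyticRank_eq_one_twist_neg13_of_rankOneTwoConverseCMSevenAdditiveTwo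
    (h : Summit.BirchSwinnertonDyer.BirchSwinnertonDyer.Theses.GoldfeldAllTwistsTwoConverse.RankOneTwoConverseCMSevenAdditiveTwo)
    (W : WeierstrassCurve ℚ) [W.IsElliptic] (C : VariableChange ℚ) (hC : C • W = cm7.quadraticTwist (-13)) :
    W.analyticRank = 1 := by
  obtain ⟨C', hmin⟩ := hasGlobalMinimalModel_rat_holds W
  haveI := hmin
  have hC' : (C * C'⁻¹) • (C' • W) = cm7.quadraticTwist (-13) := by rw [mul_smul, inv_smul_smul, hC]
  have hmin1 : (C' • W).analyticRank = 1 :=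
    h (C' • W)
      (j_eq_neg3375_of_model_twist cm7 j_cm7 (t := (-13 : ℚ)) (by norm_num) _ ⟨_, (eq_inv_smul_iff.mpr hC').symm⟩)
      (not_hasGoodReductionAtPrime_two_twist_neg13_neg26 _ _ (Or.inl rfl) (by rw [hC']; norm_num))
      (selmerCorank_two_eq_one_twist_neg13 _ _ hC')
  rw [← hmin1]
  exact (analyticRank_variableChange_holds W C').symm

/-- **K12₂″ BY NAME ⟹ `ord_{s=1} L(49a1^{(−26)}, s) = 1`** (every model; conductor `529984`, beyond every
tabulated range). [cite: SilvermanAEC2009, App. C §16] -/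
theorem analyticRank_eq_one_twist_neg26_of_rankOneTwoConverseCMSevenAdditiveTwo
    (h : Summit.BirchSwinnertonDyer.BirchSwinnertonDyer.Theses.GoldfeldAllTwistsTwoConverse.RankOneTwoConverseCMSevenAdditiveTwo)
    (W : WeierstrassCurve ℚ) [W.IsElliptic] (C : VariableChange ℚ) (hC : C • W = cm7.quadraticTwist (-26)) :
    W.analyticRank = 1 := by
  obtain ⟨C', hmin⟩ := hasGlobalMinimalModel_rat_holds W
  haveI := hmin
  have hC' : (C * C'⁻¹) • (C' • W) = cm7.quadraticTwist (-26) := by rw [mul_smul, inv_smul_smul, hC]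
  have hmin1 : (C' • W).analyticRank = 1 :=
    h (C' • W)
      (j_eq_neg3375_of_model_twist cm7 j_cm7 (t := (-26 : ℚ)) (by norm_num) _ ⟨_, (eq_inv_smul_iff.mpr hC').symm⟩)
      (not_hasGoodReductionAtPrime_two_twist_neg13_neg26 _ _ (Or.inr rfl) (by rw [hC']; norm_num))
      (selmerCorank_two_eq_one_twist_neg26 _ _ hC')
  rw [← hmin1]
  exact (analyticRank_variableChange_holds W C').symm

end Summit.BirchSwinnertonDyer.BirchSwinnertonDyer.Theorems.GoldfeldGoodTwists

end
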